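import Summits.MatrixMultiplication.MatrixMultiplication.Theorems.SoloBlindTwinMove

/-!
# The Kraft inequality (K₃) reduces to zero-sum-free SETS (all ranks)

Sub-programme (K₃): for `h` zero-sum free on `S` in a group of exponent `3` and any target `τ`, the Kraft mass
`K(τ; S) = ∑_{T ⊆ S, ∑_T h = τ} 2^{-|T|}` (`soloBlindMass`) is conjectured to be `≤ 1` (for `τ = 0` this is the
trivial statement that only `∅` represents `0`).

The twin move of `SoloBlindTwinMove` uses neither H-goodness nor anything about `τ`: if `x ≠ x'` are twins
(`h x' = h x`) then in `G ⧸ ℤ(h x)` the image of `h` is zero-sum free on `S \ {x, x'}` and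
`K(τ; S) ≤ K'([τ]; S \ {x, x'})`.  Hence (`soloBlind_kraft_of_sets`): if (K₃) holds for every exponent-`3`
group (of a fixed universe) and every INJECTIVE zero-sum-free `h` (a zero-sum-free set), then (K₃) holds for all
zero-sum-free sequences.  Together with `soloBlind_conjE_of_sets` this puts the whole conjecture on sets.
-/

namespace Summit.MatrixMultiplication.MatrixMultiplication.Theorems

open Finset

universe u

variable {ι : Type*} [DecidableEq ι]
variable {G : Type u} [AddCommGroup G] [DecidableEq G]

omit [DecidableEq ι] in
/-- For a zero-sum-free `h`, the target `0` is represented only by `∅`: `K(0; S) = 1`. -/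
theorem soloBlind_mass_zero {h : ι → G} {S : Finset ι}
    (zsf : ∀ T ⊆ S, T.Nonempty → ∑ i ∈ T, h i ≠ 0) : soloBlindMass h S 0 = 1 := by
  classical
  have hF : soloBlindSeqRepAll h S 0 = {∅} := by
    ext T
    rw [soloBlind_mem_seqRepAll, Finset.mem_singleton]
    constructor
    · rintro ⟨hTS, hsum⟩
      by_contra hne
      exact zsf T hTS (Finset.nonempty_iff_ne_empty.mpr hne) hsum
    · rintro rfl; exact ⟨Finset.empty_subset _, Finset.sum_empty⟩
  rw [soloBlindMass, hF, Finset.sum_singleton, Finset.card_empty, pow_zero]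

/-- (K₃) REDUCES TO ZERO-SUM-FREE SETS (all ranks): if `K(σ; S') ≤ 1` for every exponent-`3` group (in the
universe of `G`), every `h'` zero-sum free and injective on `S'` and every target `σ`, then `K(τ; S) ≤ 1` for every
zero-sum-free sequence `h` on `S` and every target `τ`. -/
theorem soloBlind_kraft_of_sets
    (hsets : ∀ {G : Type u} [AddCommGroup G] [DecidableEq G], (∀ g : G, g + g + g = 0) →
      ∀ (h : ι → G) (S : Finset ι), (∀ T ⊆ S, T.Nonempty → ∑ i ∈ T, h i ≠ 0) →
      (∀ x ∈ S, ∀ x' ∈ S, h x = h x' → x = x') →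
      ∀ τ : G, soloBlindMass h S τ ≤ 1)
    (three : ∀ g : G, g + g + g = 0) (h : ι → G) (S : Finset ι)
    (zsf : ∀ T ⊆ S, T.Nonempty → ∑ i ∈ T, h i ≠ 0) (τ : G) : soloBlindMass h S τ ≤ 1 := by
  suffices H : ∀ n : ℕ, ∀ {G : Type u} [AddCommGroup G] [DecidableEq G], (∀ g : G, g + g + g = 0) →
      ∀ (h : ι → G) (S : Finset ι), S.card ≤ n → (∀ T ⊆ S, T.Nonempty → ∑ i ∈ T, h i ≠ 0) →
      ∀ τ : G, soloBlindMass h S τ ≤ 1 from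
    H S.card three h S le_rfl zsf τ
  intro n
  induction n using Nat.strong_induction_on with
  | _ n ih =>
    intro G _ _ three h S hSn zsf τ
    classical
    by_cases htwin : ∃ x ∈ S, ∃ x' ∈ S, x ≠ x' ∧ h x' = h x
    · obtain ⟨x, hx, x', hx', hxx', htw⟩ := htwin
      have hker := soloBlind_quot_ker three (h x)
      have three' := soloBlind_quot_three three (AddSubgroup.zmultiples (h x))
      have hπx : QuotientAddGroup.mk' (AddSubgroup.zmultiples (h x)) (h x) = 0 :=
        (QuotientAddGroup.eq_zero_iff _).mpr (AddSubgroup.mem_zmultiples _)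
      have zsf' := soloBlind_twin_zsf three zsf hx hx' hxx' htw _ hker
      have hmove := soloBlind_mass_twin_move zsf τ hx hx' hxx' htw _ hπx
      have hsub : ({x, x'} : Finset ι) ⊆ S :=
        Finset.insert_subset hx (Finset.singleton_subset_iff.mpr hx')
      have hcard : (S \ {x, x'}).card < n := by
        have := Finset.card_sdiff_add_card_eq_card hsub
        rw [Finset.card_pair hxx'] at this
        omega
      have ih' := ih _ hcard three' _ (S \ {x, x'}) le_rfl zsf'
        (QuotientAddGroup.mk' (AddSubgroup.zmultiples (h x)) τ)
      exact le_trans hmove ih'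
    · push Not at htwin
      refine hsets three h S zsf ?_ τ
      intro a ha b hb e
      by_contra hab
      exact htwin a ha b hb hab e.symm

/-- In particular every value `h p`, `p ∈ S`, has Kraft mass `K(h p; S) = 1/2 + K(h p; S \ {p})`: the singleton
`{p}` and the representations avoiding `p` (no representation of `h p` contains `p` properly, by
zero-sum-freeness). -/
theorem soloBlind_mass_value_split {h : ι → G} {S : Finset ι}
    (zsf : ∀ T ⊆ S, T.Nonempty → ∑ i ∈ T, h i ≠ 0) {p : ι} (hp : p ∈ S) :
    soloBlindMass h S (h p) = 1 / 2 + soloBlindMass h (S.erase p) (h p) := by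
  classical
  have hp' : p ∉ S.erase p := Finset.notMem_erase p S
  have key : soloBlindSeqRepAll h S (h p) = insert {p} (soloBlindSeqRepAll h (S.erase p) (h p)) := by
    ext T
    rw [Finset.mem_insert, soloBlind_mem_seqRepAll, soloBlind_mem_seqRepAll]
    constructor
    · rintro ⟨hTS, hsum⟩
      by_cases hpT : p ∈ T
      · left
        -- `T.erase p` is a zero sum inside `S`, hence empty
        have hsum' : ∑ i ∈ T.erase p, h i = 0 := by
          have := Finset.add_sum_erase T h hpT
          rw [hsum] at this
          -- h p + ∑ erase = h p
          have := add_left_cancel (a := h p) (this.trans (add_zero (h p)).symm)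
          exact this
        have hempty : T.erase p = ∅ := by
          by_contra hne
          exact zsf (T.erase p) ((Finset.erase_subset p T).trans hTS)
            (Finset.nonempty_iff_ne_empty.mpr hne) hsum'
        rw [← Finset.insert_erase hpT, hempty]
        rfl
      · right
        exact ⟨fun i hi => Finset.mem_erase.mpr ⟨fun e => hpT (e ▸ hi), hTS hi⟩, hsum⟩
    · rintro (rfl | ⟨hTS, hsum⟩)
      · exact ⟨Finset.singleton_subset_iff.mpr hp, Finset.sum_singleton _ _⟩
      · exact ⟨hTS.trans (Finset.erase_subset p S), hsum⟩
  have hnot : ({p} : Finset ι) ∉ soloBlindSeqRepAll h (S.erase p) (h p) := by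
    intro hmem
    have := (soloBlind_mem_seqRepAll.mp hmem).1 (Finset.mem_singleton_self p)
    exact hp' this
  rw [soloBlindMass, key, Finset.sum_insert hnot, Finset.card_singleton, pow_one, soloBlindMass]

/-- CONJECTURE E IMPLIES (K₃) ON THE VALUE STRATUM: if `E(σ; S') ≤ 1/2` for all H-good `σ` on subsets `S'` of `S`
(here: for `σ = h p` on `S \ {p}`), then `K(h p; S) ≤ 1`. -/
theorem soloBlind_kraft_value_of_conjE (three : ∀ g : G, g + g + g = 0) {h : ι → G} {S : Finset ι}
    (zsf : ∀ T ⊆ S, T.Nonempty → ∑ i ∈ T, h i ≠ 0) {p : ι} (hp : p ∈ S)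
    (hE : (∀ T ⊆ S.erase p, ∑ i ∈ T, h i ≠ h p + h p) → soloBlindMass h (S.erase p) (h p) ≤ 1 / 2) :
    soloBlindMass h S (h p) ≤ 1 := by
  have hgood : ∀ T ⊆ S.erase p, ∑ i ∈ T, h i ≠ h p + h p :=
    soloBlind_hgood_of_outside_value three zsf (Finset.erase_subset p S) hp (Finset.notMem_erase p S)
  rw [soloBlind_mass_value_split zsf hp]
  have := hE hgood
  linarith

end Summit.MatrixMultiplication.MatrixMultiplication.Theorems
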